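import Mathlib

/-!
# `FeketeSOS.FeketeSOSHard` (stmt-ValiantsHypothesis-3996), idea `depth-spectrum-gap` — the bold gap with `C = 1` is false

Crux-triage round 2, triager 2 (`Cruxes/FeketeSOSHard/TRIAGE-r2-2.md`).  The card `depth-spectrum-gap`
(`Cruxes/FeketeSOSHard/Sketch_ideator5.lean`, namespace `…Cruxes.FeketeSOSHard.DepthSpectrumGap`) proposes the
TWO-SIDED order–sparsity law `DepthSpectrumGapWith C`: over a field of characteristic `p`, a sum `∑_{j<r} A_j B_j` of
products of polynomials of degree `< p`, not divisible by `X^p - 1`, of EXACT order `M` at `X = 1`, has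
`M ≤ C·T ∨ p ≤ M + 1 + C·T` with `T = ∑_j (#supp A_j + #supp B_j)`, and records "`C = 1` fits all ≈ 8 300 measured
families".  THIS FILE refutes `C = 1`: over `ZMod 29`,
`A₀ = 1 + 11 X + 13 X³`, `B₀ = 11 X³ + 2 X⁶ + 6 X⁹ + 12 X¹¹ + 3 X¹⁴ + 2 X¹⁶`, and
`E = A₀·B₀ + (-1)·1` (two products, `T = 3 + 6 + 1 + 1 = 11`, all degrees `< 29`, `deg E = 19`) satisfies
`(X - 1)^12 ∥ E` — an exact order `M = 12` with `T = 11 < 12 < 17 = p - 1 - T`, i.e. strictly inside the conjectured gap.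
Certificate: the INTEGER identity `A₀ B₀ - 1 - (X-1)^12 Q₀ = 29 · W₀` (`ring`), `Q₀(1) = 146 ≡ 1 (mod 29)`.
(Found by Berlekamp–Massey on the power moments of `A₀⁻¹ ∈ 𝔽₂₉[X]/(X²⁹ - 1)`; such witnesses are abundant for
`p ≥ 29` — kit job j016435 — at the rate the naive parameter count predicts, so the live bold form is `C = 2`.)

The refuted statement is `DepthSpectrumGap.DepthSpectrumGapWith` VERBATIM with `pairSupport A B` unfolded to
`∑ j, ((A j).support.card + (B j).support.card)` and `C = 1` substituted (statement inlined in the theorem, no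
`def : Prop`), so `not_depthSpectrumGapWith_one` is an `Iff.rfl`-bridge to `¬ DepthSpectrumGapWith 1` for anyone
importing the sketch.  The witness polynomials are local notations (no definitions).  Mathlib only; theorems only;
no facts. [folklore; explicit witness]
-/

namespace Summit.ValiantsHypothesis.ValiantsHypothesis.Theorems.FeketeSOSHard.Negative

open Polynomial Finset

-- `Summit.ValiantsHypothesis.ValiantsHypothesis.…` is the tree's mandated single-conjunct layout (Sub = Summit).
set_option linter.dupNamespace false

noncomputable section

/-! ## The witness over `ZMod 29` (local notations) -/

/-- `A₀ = 1 + 11X + 13X³`. -/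
local notation "dsgA" => (1 + 11 * X + 13 * X ^ 3 : (ZMod 29)[X])
/-- `B₀ = 11X³ + 2X⁶ + 6X⁹ + 12X¹¹ + 3X¹⁴ + 2X¹⁶`. -/
local notation "dsgB" =>
  (11 * X ^ 3 + 2 * X ^ 6 + 6 * X ^ 9 + 12 * X ^ 11 + 3 * X ^ 14 + 2 * X ^ 16 : (ZMod 29)[X])
/-- The cofactor `Q₀ = (A₀B₀ - 1)/(X-1)^12` (degree 7, `Q₀(1) = 1`). -/
local notation "dsgQ" =>
  (28 + 17 * X + 9 * X ^ 2 + 24 * X ^ 3 + 19 * X ^ 4 + X ^ 5 + 22 * X ^ 6 + 26 * X ^ 7 : (ZMod 29)[X])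
/-- The integer carry `W₀ = (A₀B₀ - 1 - (X-1)^12 Q₀)/29` of the lift. -/
local notation "dsgW" =>
  (-1 + 11 * X - 57 * X ^ 2 + 177 * X ^ 3 - 356 * X ^ 4 + 496 * X ^ 5 - 438 * X ^ 6 + 210 * X ^ 7
    - X ^ 8 + 14 * X ^ 9 - 187 * X ^ 10 + 276 * X ^ 11 - 113 * X ^ 12 - 152 * X ^ 13 + 314 * X ^ 14
    - 271 * X ^ 15 + 147 * X ^ 16 - 48 * X ^ 17 + 10 * X ^ 18 : (ZMod 29)[X])
/-- The two products: `A = (A₀, -1)`, `B = (B₀, 1)`. -/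
local notation "dsgAwit" => (![dsgA, -1] : Fin 2 → (ZMod 29)[X])
/-- See `dsgAwit`. -/
local notation "dsgBwit" => (![dsgB, 1] : Fin 2 → (ZMod 29)[X])

/-- The configuration's sum is `A₀B₀ - 1`. -/
theorem dsg_sum_wit : (∑ j, dsgAwit j * dsgBwit j) = dsgA * dsgB - 1 := by
  simp [Fin.sum_univ_two, sub_eq_add_neg]

/-- The integer identity behind the certificate (true in every commutative ring). -/
theorem dsg_int_identity : dsgA * dsgB - 1 - (X - 1) ^ 12 * dsgQ = 29 * dsgW := by
  ring

/-- `29 = 0` in `(ZMod 29)[X]`. -/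
theorem dsg_twentynine_eq_zero : (29 : (ZMod 29)[X]) = 0 := by
  have h1 : (29 : (ZMod 29)[X]) = Polynomial.C (29 : ZMod 29) := by rw [map_ofNat]
  have h2 : (29 : ZMod 29) = 0 := by decide
  rw [h1, h2, map_zero]

/-- `A₀B₀ - 1 = (X-1)^12 · Q₀` over `ZMod 29`. -/
theorem dsg_key : dsgA * dsgB - 1 = (X - 1) ^ 12 * dsgQ := by
  have h := dsg_int_identity
  rw [dsg_twentynine_eq_zero, zero_mul, sub_eq_zero] at h
  exact h

/-- `Q₀(1) = 146 = 1` in `ZMod 29`. -/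
theorem dsgQ_eval_one : (dsgQ).eval 1 = 1 := by
  simp
  decide

/-- Exactness: `(X-1)^13 ∤ A₀B₀ - 1` because `Q₀(1) ≠ 0`. -/
theorem dsg_not_dvd_13 : ¬ ((X - 1 : (ZMod 29)[X]) ^ 13 ∣ dsgA * dsgB - 1) := by
  haveI : Fact (Nat.Prime 29) := ⟨by norm_num⟩
  rw [dsg_key, pow_succ]
  intro h
  have hne : ((X - 1 : (ZMod 29)[X]) ^ 12) ≠ 0 := by
    apply pow_ne_zero
    simpa using X_sub_C_ne_zero (1 : ZMod 29)
  have h' : (X - 1 : (ZMod 29)[X]) ∣ dsgQ := (mul_dvd_mul_iff_left hne).mp h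
  have hroot : (dsgQ).IsRoot 1 := by
    rw [← dvd_iff_isRoot]
    simpa using h'
  have h0 : (dsgQ).eval 1 = 0 := hroot
  rw [dsgQ_eval_one] at h0
  exact one_ne_zero h0

/-- `A₀B₀ - 1 ≠ 0`. -/
theorem dsg_E_ne_zero : dsgA * dsgB - 1 ≠ 0 := by
  intro h
  apply dsg_not_dvd_13
  rw [h]
  exact dvd_zero _

/-- `deg (A₀B₀ - 1) ≤ 19`. -/
theorem dsg_natDegree_E_le : (dsgA * dsgB - 1).natDegree ≤ 19 := by
  compute_degree

/-- Non-vanishing modulo `X^29 - 1`: `E ≠ 0` has degree `19 < 29`. -/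
theorem dsg_not_dvd_Xp : ¬ ((X : (ZMod 29)[X]) ^ 29 - 1 ∣ dsgA * dsgB - 1) := by
  haveI : Fact (Nat.Prime 29) := ⟨by norm_num⟩
  intro h
  have h1 := natDegree_le_of_dvd h dsg_E_ne_zero
  have h2 : ((X : (ZMod 29)[X]) ^ 29 - 1).natDegree = 29 := by
    rw [← C_1, natDegree_X_pow_sub_C]
  have h3 := dsg_natDegree_E_le
  omega

/-- `deg A₀ ≤ 3`. -/
theorem dsg_natDegree_A_le : (dsgA).natDegree ≤ 3 := by
  compute_degree

/-- `deg B₀ ≤ 16`. -/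
theorem dsg_natDegree_B_le : (dsgB).natDegree ≤ 16 := by
  compute_degree

/-- All four factors have degree `< 29`. -/
theorem dsg_deg_wit : ∀ j, (dsgAwit j).natDegree < 29 ∧ (dsgBwit j).natDegree < 29 := by
  intro j
  fin_cases j
  · simp only [Fin.zero_eta, Fin.isValue, Matrix.cons_val_zero]
    exact ⟨lt_of_le_of_lt dsg_natDegree_A_le (by norm_num), lt_of_le_of_lt dsg_natDegree_B_le (by norm_num)⟩
  · simp

/-! ### Support counts: `T = 3 + 6 + 1 + 1 = 11` (upper bounds suffice) -/

/-- `#supp (p + q) ≤ #supp p + #supp q`. -/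
theorem dsg_card_support_add_le (p q : (ZMod 29)[X]) :
    (p + q).support.card ≤ p.support.card + q.support.card :=
  (card_le_card support_add).trans (card_union_le _ _)

/-- A sum of `|l|` monomials (given as (coefficient, exponent) pairs) has at most `|l|` terms. -/
theorem dsg_card_support_sparse_le (l : List (ℕ × ℕ)) :
    ((l.map fun ce : ℕ × ℕ => C (ce.1 : ZMod 29) * X ^ ce.2).sum).support.card ≤ l.length := by
  induction l with
  | nil => simp
  | cons a l ih =>
    rw [List.map_cons, List.sum_cons, List.length_cons]
    calc (C (a.1 : ZMod 29) * X ^ a.2 + (l.map fun ce : ℕ × ℕ => C (ce.1 : ZMod 29) * X ^ ce.2).sum).support.card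
        ≤ (C (a.1 : ZMod 29) * X ^ a.2).support.card
            + ((l.map fun ce : ℕ × ℕ => C (ce.1 : ZMod 29) * X ^ ce.2).sum).support.card :=
          dsg_card_support_add_le _ _
      _ ≤ 1 + l.length := Nat.add_le_add card_support_C_mul_X_pow_le_one ih
      _ = l.length + 1 := by omega

/-- `A₀` as a list of monomials. -/
theorem dsgA_eq_sparse :
    dsgA = ([(1, 0), (11, 1), (13, 3)].map fun ce : ℕ × ℕ => C (ce.1 : ZMod 29) * X ^ ce.2).sum := by
  simp
  ring

/-- `B₀` as a list of monomials. -/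
theorem dsgB_eq_sparse :
    dsgB = ([(11, 3), (2, 6), (6, 9), (12, 11), (3, 14), (2, 16)].map
      fun ce : ℕ × ℕ => C (ce.1 : ZMod 29) * X ^ ce.2).sum := by
  simp
  ring

/-- `#supp A₀ ≤ 3`. -/
theorem dsg_card_support_A : (dsgA).support.card ≤ 3 := by
  rw [dsgA_eq_sparse]; exact dsg_card_support_sparse_le _

/-- `#supp B₀ ≤ 6`. -/
theorem dsg_card_support_B : (dsgB).support.card ≤ 6 := by
  rw [dsgB_eq_sparse]; exact dsg_card_support_sparse_le _

/-- `#supp 1 ≤ 1`. -/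
theorem dsg_card_support_one : (1 : (ZMod 29)[X]).support.card ≤ 1 := by
  have : (1 : (ZMod 29)[X]) = ([(1, 0)].map fun ce : ℕ × ℕ => C (ce.1 : ZMod 29) * X ^ ce.2).sum := by
    simp
  rw [this]; exact dsg_card_support_sparse_le _

/-- `#supp (-1) ≤ 1`. -/
theorem dsg_card_support_neg_one : (-1 : (ZMod 29)[X]).support.card ≤ 1 := by
  rw [support_neg]; exact dsg_card_support_one

/-- Support-sum of the configuration: `T ≤ 3 + 6 + 1 + 1 = 11`. -/
theorem dsg_pairSupport_le :
    (∑ j, ((dsgAwit j).support.card + (dsgBwit j).support.card)) ≤ 11 := by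
  rw [Fin.sum_univ_two]
  simp only [Fin.isValue, Matrix.cons_val_zero, Matrix.cons_val_one]
  have hA := dsg_card_support_A
  have hB := dsg_card_support_B
  have hn := dsg_card_support_neg_one
  have h1 := dsg_card_support_one
  omega

/-! ## The refutation -/

/-- **`DepthSpectrumGapWith 1` is false** (the card's `DepthSpectrumGap.DepthSpectrumGapWith C` VERBATIM at `C = 1`,
`pairSupport A B` unfolded to `∑ j, ((A j).support.card + (B j).support.card)`): over `ZMod 29` the two-product
configuration `(1 + 11X + 13X³)(11X³ + 2X⁶ + 6X⁹ + 12X¹¹ + 3X¹⁴ + 2X¹⁶) + (-1)·1` has exact `(X-1)`-order `12`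
while its support-sum is `≤ 11` and `12 + 1 + 11 = 24 < 29`: the depth `12` lies strictly inside the conjectured
gap `(T, p-1-T) = (11, 17)`. -/
theorem not_depthSpectrumGapWith_one :
    ¬ (∀ (K : Type) [Field K] (p : ℕ) [Fact p.Prime] [CharP K p] (r : ℕ) (A B : Fin r → K[X]) (M : ℕ),
        (∀ j, (A j).natDegree < p ∧ (B j).natDegree < p) →
        ¬ ((X : K[X]) ^ p - 1 ∣ ∑ j, A j * B j) →
        (X - 1 : K[X]) ^ M ∣ ∑ j, A j * B j →
        ¬ ((X - 1 : K[X]) ^ (M + 1) ∣ ∑ j, A j * B j) →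
        M ≤ 1 * ∑ j, ((A j).support.card + (B j).support.card) ∨
          p ≤ M + 1 + 1 * ∑ j, ((A j).support.card + (B j).support.card)) := by
  intro h
  haveI : Fact (Nat.Prime 29) := ⟨by norm_num⟩
  have hmain := h (ZMod 29) 29 2 dsgAwit dsgBwit 12 dsg_deg_wit
    (by rw [dsg_sum_wit]; exact dsg_not_dvd_Xp)
    (by rw [dsg_sum_wit, dsg_key]; exact dvd_mul_right _ _)
    (by rw [dsg_sum_wit]; exact dsg_not_dvd_13)
  have key : ∀ T : ℕ, T ≤ 11 → ¬ (12 ≤ 1 * T ∨ 29 ≤ 12 + 1 + 1 * T) := by omega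
  exact key _ dsg_pairSupport_le hmain

end

end Summit.ValiantsHypothesis.ValiantsHypothesis.Theorems.FeketeSOSHard.Negative
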